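import Summits.RiemannHypothesis.RiemannHypothesis.Theorems.PfPersistenceM2OddSectorEncard
import HarnessLib

/-!
# Pf-persistence index route (M2): the negative index of a window as a number, and its limit

Long-odds MECHANISM SEARCH (cell `pub-rhpf`, seat M2); every result here is RH-free and makes no
claim about RH.  Notation: `𝒬 = {ρ : ζ(ρ) = 0 non-trivial, Re ρ > 1/2, Im ρ > 0}`, `K = #𝒬 ∈ ℕ ∪ {∞}`
(`Set.encard`), and for a window `[-a, a]` the NEGATIVE INDEX of the Weil form `Re Q` on the even /
odd / all real compactly supported Weil tests living in the window,
`ind⁻_ev(a) = ⨆ {n : EvenNegIndexAtLeast n a}`, `ind⁻_od(a)`, `ind⁻_re(a)` (values in `ℕ∞`; written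
below as iterated `iSup`s, no new definitions).

PROVED here (RH-free, UNCONDITIONAL), packaging the two-parity ladder
(`twoParity_index_ladder_encard`) as three identities and three limits:
* `iSup_evenNegIndex_eq_encard`     : `⨆ₐ ind⁻_ev(a) = K`,
  `iSup_oddNegIndex_eq_encard`      : `⨆ₐ ind⁻_od(a) = K`,
  `iSup_realNegIndex_eq_two_mul_encard` : `⨆ₐ ind⁻_re(a) = 2K`;
* `tendsto_evenNegIndex_atTop`, `tendsto_oddNegIndex_atTop`, `tendsto_realNegIndex_atTop` :
  `ind⁻_ev(a) → K`, `ind⁻_od(a) → K`, `ind⁻_re(a) → 2K` as `a → ∞` (in the order topology of `ℕ∞`;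
  the indices are monotone in `a`) — "the eventual negative index of the Weil form counts the
  off-line zeros, parity by parity", for every `K ∈ ℕ ∪ {∞}`.
The abstract engine is `iSup_natCast_eq_of_exists_iff` / `tendsto_iSup_natCast_of_exists_iff`:
any predicate `P n a`, monotone in `a`, with `(∃ a, P n a) ⟺ n ≤ K` for all `n`, has `⨆ = K` and
`→ K`.  `K = 0 ⟺ RH` is untouched: nothing here says what `K` is.
-/

noncomputable section

open Filter Set
open scoped Topology

namespace Summit.RiemannHypothesis.RiemannHypothesis.Theorems.PfPersistenceM2NegIndex

open Literature.NumberTheory.LFunctions.ZetaZeros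
open Summit.RiemannHypothesis.RiemannHypothesis.Theorems.PfPersistenceParityIndex (OddNegIndexAtLeast)

/-! ## A. Abstract: a ladder `(∃ a, P n a) ⟺ n ≤ K` determines `⨆` and `lim` -/

/-- If `(∃ a, P n a) ⟺ n ≤ K` for every `n` (`K : ℕ∞`), then `⨆ₐ ⨆ {n : P n a} = K`. [folklore] -/
theorem iSup_natCast_eq_of_exists_iff {P : ℕ → ℝ → Prop} {K : ℕ∞}
    (h : ∀ n : ℕ, (∃ a : ℝ, P n a) ↔ (n : ℕ∞) ≤ K) :
    (⨆ a : ℝ, ⨆ n : ℕ, ⨆ _ : P n a, (n : ℕ∞)) = K := by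
  apply le_antisymm
  · exact iSup_le fun a ↦ iSup_le fun n ↦ iSup_le fun hn ↦ (h n).1 ⟨a, hn⟩
  · induction K using ENat.recTopCoe with
    | top =>
      rw [top_le_iff]
      by_contra hS
      obtain ⟨s, hs⟩ := ENat.ne_top_iff_exists.1 hS
      obtain ⟨a, ha⟩ := (h (s + 1)).2 le_top
      have h1 : ((s + 1 : ℕ) : ℕ∞) ≤ ⨆ a : ℝ, ⨆ n : ℕ, ⨆ _ : P n a, (n : ℕ∞) :=
        le_iSup_of_le a (le_iSup_of_le (s + 1) (le_iSup_of_le ha le_rfl))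
      rw [← hs] at h1
      have h2 : s + 1 ≤ s := by exact_mod_cast h1
      omega
    | coe k =>
      obtain ⟨a, ha⟩ := (h k).2 le_rfl
      exact le_iSup_of_le a (le_iSup_of_le k (le_iSup_of_le ha le_rfl))

/-- … and if moreover `P n ·` is monotone in the window, `⨆ {n : P n a} → K` as `a → ∞`. [folklore] -/
theorem tendsto_iSup_natCast_of_exists_iff {P : ℕ → ℝ → Prop} {K : ℕ∞}
    (h : ∀ n : ℕ, (∃ a : ℝ, P n a) ↔ (n : ℕ∞) ≤ K)
    (hmono : ∀ n (a b : ℝ), P n a → a ≤ b → P n b) :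
    Tendsto (fun a : ℝ ↦ ⨆ n : ℕ, ⨆ _ : P n a, (n : ℕ∞)) atTop (𝓝 K) := by
  have hm : Monotone fun a : ℝ ↦ ⨆ n : ℕ, ⨆ _ : P n a, (n : ℕ∞) := fun a b hab ↦
    iSup_mono fun n ↦ iSup_mono' fun hn ↦ ⟨hmono n a b hn hab, le_rfl⟩
  have ht := tendsto_atTop_iSup hm
  rwa [iSup_natCast_eq_of_exists_iff h] at ht

/-! ## B. The three negative indices of the Weil form -/

/-- **`⨆ₐ ind⁻_ev(a) = K`** (RH-free, unconditional, every `K ∈ ℕ ∪ {∞}`).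
[cite: Bombieri2000Weil, Thm 9 (even part); Thm 11] -/
theorem iSup_evenNegIndex_eq_encard :
    (⨆ a : ℝ, ⨆ n : ℕ, ⨆ _ : EvenNegIndexAtLeast n a, (n : ℕ∞)) =
      {ρ : ℂ | ρ ∈ riemannZetaNontrivialZeros ∧ 1 / 2 < ρ.re ∧ 0 < ρ.im}.encard :=
  iSup_natCast_eq_of_exists_iff exists_evenNegIndexAtLeast_iff_encard

/-- **`⨆ₐ ind⁻_od(a) = K`** (RH-free, unconditional, every `K ∈ ℕ ∪ {∞}`).
[cite: Bombieri2000Weil, Thm 9 (odd part); Thm 11] -/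
theorem iSup_oddNegIndex_eq_encard :
    (⨆ a : ℝ, ⨆ n : ℕ, ⨆ _ : OddNegIndexAtLeast n a, (n : ℕ∞)) =
      {ρ : ℂ | ρ ∈ riemannZetaNontrivialZeros ∧ 1 / 2 < ρ.re ∧ 0 < ρ.im}.encard :=
  iSup_natCast_eq_of_exists_iff exists_oddNegIndexAtLeast_iff_encard

/-- **`⨆ₐ ind⁻_re(a) = 2K`** (RH-free, unconditional, every `K ∈ ℕ ∪ {∞}`).
[cite: Bombieri2000Weil, Thm 8; Thm 11] -/
theorem iSup_realNegIndex_eq_two_mul_encard :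
    (⨆ a : ℝ, ⨆ n : ℕ, ⨆ _ : RealNegIndexAtLeast n a, (n : ℕ∞)) =
      2 * {ρ : ℂ | ρ ∈ riemannZetaNontrivialZeros ∧ 1 / 2 < ρ.re ∧ 0 < ρ.im}.encard :=
  iSup_natCast_eq_of_exists_iff exists_realNegIndexAtLeast_iff_encard

/-- **Eventual even index: `ind⁻_ev(a) → K` as `a → ∞`** (RH-free, unconditional).
[cite: Bombieri2000Weil, Thm 9 (even part); Thm 11] -/
theorem tendsto_evenNegIndex_atTop :
    Tendsto (fun a : ℝ ↦ ⨆ n : ℕ, ⨆ _ : EvenNegIndexAtLeast n a, (n : ℕ∞)) atTop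
      (𝓝 {ρ : ℂ | ρ ∈ riemannZetaNontrivialZeros ∧ 1 / 2 < ρ.re ∧ 0 < ρ.im}.encard) :=
  tendsto_iSup_natCast_of_exists_iff exists_evenNegIndexAtLeast_iff_encard
    fun _ _ _ h hab ↦ h.mono hab

/-- **Eventual odd index: `ind⁻_od(a) → K` as `a → ∞`** (RH-free, unconditional).
[cite: Bombieri2000Weil, Thm 9 (odd part); Thm 11] -/
theorem tendsto_oddNegIndex_atTop :
    Tendsto (fun a : ℝ ↦ ⨆ n : ℕ, ⨆ _ : OddNegIndexAtLeast n a, (n : ℕ∞)) atTop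
      (𝓝 {ρ : ℂ | ρ ∈ riemannZetaNontrivialZeros ∧ 1 / 2 < ρ.re ∧ 0 < ρ.im}.encard) :=
  tendsto_iSup_natCast_of_exists_iff exists_oddNegIndexAtLeast_iff_encard
    fun _ _ _ h hab ↦ PfPersistenceParityIndex.OddNegIndexAtLeast.mono h hab

/-- **Eventual real index: `ind⁻_re(a) → 2K` as `a → ∞`** (RH-free, unconditional).
[cite: Bombieri2000Weil, Thm 8; Thm 11] -/
theorem tendsto_realNegIndex_atTop :
    Tendsto (fun a : ℝ ↦ ⨆ n : ℕ, ⨆ _ : RealNegIndexAtLeast n a, (n : ℕ∞)) atTop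
      (𝓝 (2 * {ρ : ℂ | ρ ∈ riemannZetaNontrivialZeros ∧ 1 / 2 < ρ.re ∧ 0 < ρ.im}.encard)) :=
  tendsto_iSup_natCast_of_exists_iff exists_realNegIndexAtLeast_iff_encard
    fun _ _ _ h hab ↦ h.mono hab

end Summit.RiemannHypothesis.RiemannHypothesis.Theorems.PfPersistenceM2NegIndex

end
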